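import Summits.BirchSwinnertonDyer.BirchSwinnertonDyer.Theorems.EisensteinPrimesAnomalousTowerTorsionFinite
import Summits.BirchSwinnertonDyer.Rank1Residual.X2.ResidualDevissageModules
import Literature.NumberTheory.GaloisRepresentations.FrobeniusGeneration
import HarnessLib

/-!
# Route `EisensteinPrimes`, crux 2 `GoodLatticeBDPValue` (stmt-BirchSwinnertonDyer-19032), line `halves` v20:
# the LOCAL `H⁰` inputs of `stub_indexInputs` at the anomalous place `v̄` —
# `D_v̄` acts TRIVIALLY on `E_K[p]/Φ` (`𝟙̃|_{G_v̄} = 𝟙`), `Φ^{ker κ ⊓ D_v̄} = 0`, `E(K_{∞,v̄})[p^∞]` finite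

Cell `bsd-eis`, width seat `bsd-line-x1-p1-w7` (g0; `--supports -19032`, closes nothing). Keller–Yin
arXiv:2402.12781v2 §1.4 (TeX L1066–1083) normalise the residual pair of the good lattice so that «`φ|_{G_p} = ω` and
`ψ|_{G_p} = 𝟙`». On the binders of crux 2 (`p` odd, `Anom W p` = reducible + good + `a_p ≡ 1 (mod p)`, no
unramified rational `p`-line, `K` imaginary quadratic with `p = v v̄` split) the second clause is a THEOREM about the
unique `Γ_K`-stable line `Φ ≤ E_K[p]`: the whole decomposition group `D_v̄ = GreenbergSelmer.decomp v̄ ≤ Γ_K` acts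
trivially on `E_K[p]/Φ`. These are the local `H⁰` hypotheses `htrivD`, `hN₁D`, `[Finite A₂^{H ⊓ D_𝔭}]` of the
mid-level composition `ResidualIndexAssembly.zpCorank_datumStrictSelmer_add_eq` (LEAD g4, p645893) at
`N₁ = Φ`, `N₃ = E_K[p]/Φ`, `A₂ = E_K[p^∞]`, `H = ker κ`, `𝔭 = v̄` — conjuncts of the v20 stub `stub_indexInputs`.

* §1 (over `ℚ`) **`smul_sub_mem_rationalLine_of_mem_decompositionSubgroup`**: for `E/ℚ` globally minimal with
  `p ∤ Δ`, `a_p ≡ 1 (mod p)`, the ramified rational line `Φ₀` and ANY prime `𝔔` of `\bar ℤ` above `p`: every `d`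
  in the decomposition group `D_𝔔 ≤ Γ_ℚ` satisfies `d • P − P ∈ Φ₀` for all `P ∈ E[p]`. Proof: Frobenius generation
  `D_𝔔 = ⟨φ⟩ · I_𝔔 · U` modulo the open pointwise stabiliser `U` of `E[p]`
  (`exists_eq_frobenius_pow_mul_of_mem_decompositionSubgroup`); inertia does not change the reduction
  (`geomReduction_smul_of_mem_inertia`), nor does `φ` on `E[p]` when `a_p ≡ 1` (Serre §1.11 (1),
  `geomReduction_smul_eq_self_of_dvd_frobeniusTrace_sub_one`); and the kernel of reduction on `E[p]` IS the
  ramified rational line (`mem_rationalLine_of_geomReduction_eq_zero`). First at the prime `𝔓₀` of the place, then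
  at any conjugate `𝔔 = ρ⁻¹ 𝔓₀`.
* §2 (over `K`) **`smul_sub_mem_of_mem_decomp`**: `g • P − P ∈ Φ` for every `g ∈ D_v̄`, `P ∈ E_K[p]` and every
  `Γ_K`-stable `p`-line `Φ ≤ E_K[p]` — transport along `E(ℚ̄) ≃ E_K(K̄)` (`exists_addEquiv_geomPoints_baseChange`), the
  pulled-back line being rational (`ResidualLineRigidity.isRationalLine_of_forall_restrict_smul_mem`), and
  `res(D_v̄) ≤ D_𝔔` for the contraction `𝔔` of `𝔓_{v̄}` (`decompositionSubgroup_adicCompletionPrime_eq_range`,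
  `comap_absIntegersMap_smul`). Corollaries in the `StableSubgroup` currency of the v20 stub:
  **`forall_smul_quot_eq_self_of_mem_decomp`** (`htrivD`, even for all of `D_v̄`),
  **`sub_eq_zero_of_forall_inf_decomp_smul_eq`** (`hN₁D`: `Φ^{ker κ ⊓ D_v̄} = 0`, from the mover
  `exists_mem_inertia_smul_ne` and `eq_zero_of_mem_line_of_fixed`), and
  **`finite_fixed_geomPrimaryTorsion_inf_decomp`** (`Finite {x : E_K[p^∞] // (ker κ ⊓ D_v̄) x = x}` from Fin_v,
  `localTowerTorsionFiniteAt_of_isAnticyclotomic`, p643307).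

HONEST FRAMING: helper theorems only (0 defs, 0 named facts, 0 sorry); no registered stub is closed here; no summit
statement / BSD / IMC2 / KY Thm. 1.4.1 (iii) is proved; 0 cells move. References: [KellerYin2024] §1.3–§1.4;
[Serre1972] §1.11; [NeukirchANT1999] I §9; [Mazur1972] §1 (anomalous primes).
-/

set_option autoImplicit false
-- the route's Theorems namespace repeats the summit name by design (D-0017 nested layout)
set_option linter.dupNamespace false

noncomputable section

open scoped Classical Pointwise

namespace Summit.BirchSwinnertonDyer.BirchSwinnertonDyer.Theorems.AnomalousLocalTorsion

open NumberField IsDedekindDomain Field WeierstrassCurve Rat.HeightOneSpectrum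
  Literature.NumberTheory.EllipticCurves Literature.NumberTheory.EllipticCurves.GreenbergSelmer
  Literature.NumberTheory.EllipticCurves.Rank1Residual Literature.NumberTheory.GaloisRepresentations
  Summit.BirchSwinnertonDyer.BirchSwinnertonDyer.Theorems.SchneiderFreeControlAtoms
  Summit.BirchSwinnertonDyer.BirchSwinnertonDyer.Theorems.ResidualLineRigidity
  Summit.BirchSwinnertonDyer.Rank1Residual.X2.ResidualDevissageModules

/-! ## §1. Over `ℚ`: the decomposition group acts trivially on `E[p]/Φ₀` at an anomalous prime -/

section Rat

variable {W : WeierstrassCurve ℚ} [W.IsElliptic] [W.IsGloballyMinimal] {p : ℕ} [hp : Fact p.Prime]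

/-- **`D_{𝔓₀}` acts trivially on `E[p]/Φ₀` when `a_p ≡ 1 (mod p)`** (`𝔓₀` the prime of `\bar ℤ` cut out by the place,
`Φ₀` the rational `p`-line, NOT unramified at `p`): `d • P − P ∈ Φ₀` for `d ∈ D_{𝔓₀}`, `P ∈ E[p]`. Frobenius
generation modulo the open pointwise stabiliser of `E[p]`; inertia and (as `a_p ≡ 1`) the Frobenius do not move
reductions of `p`-torsion points; the kernel of reduction on `E[p]` is `Φ₀`. KY: «`ψ|_{G_p} = 𝟙`».
[cite: KellerYin2024, §1.4 (arXiv:2402.12781v2 TeX L1066–1083)] [cite: Serre1972, §1.11 (1) and Prop. 11]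
[cite: NeukirchANT1999, I §9 Prop. (9.4)] -/
theorem smul_sub_mem_rationalLine_of_mem_decompositionSubgroup (hΔ : ¬ (p : ℤ) ∣ minimalDiscriminantInt W)
    (ha : (p : ℤ) ∣ W.frobeniusTrace p - 1) {𝔓 : Ideal (absIntegers (𝓞 ℚ) ℚ)}
    (hmem : ∀ x : absIntegers (𝓞 ℚ) ℚ, x ∈ 𝔓 ↔ (x : AlgebraicClosure ℚ) ∈ (placeOver p).nonunits)
    {v : HeightOneSpectrum (𝓞 ℚ)} (hv : (primesEquiv v : ℕ) = p) (hu : (p : 𝓞 ℚ) ∈ v.asIdeal)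
    (h𝔓 : 𝔓 ∈ v.primesAbove) {Φ₀ : AddSubgroup (geomTorsion W (p : ℤ))} (hΦ₀ : IsRationalLine W p Φ₀)
    (hram : ¬ LineUnramifiedAt W p Φ₀) {d : absoluteGaloisGroup ℚ}
    (hd : d ∈ 𝔓.decompositionSubgroup (absoluteGaloisGroup ℚ)) (P : geomTorsion W (p : ℤ)) :
    d • P - P ∈ Φ₀ := by
  have hpr : p.Prime := hp.out
  have hord : ¬ (p : ℤ) ∣ W.frobeniusTrace p := by
    intro h
    have h1 : (p : ℤ) ∣ 1 := by
      have := dvd_sub h ha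
      rwa [sub_sub_cancel] at this
    exact hpr.one_lt.ne' (by exact_mod_cast Int.eq_one_of_dvd_one (Int.natCast_nonneg p) h1)
  -- `E[p]` is finite; its pointwise stabiliser `U` is open
  have hT : Nat.card (geomTorsion W (p : ℤ)) = p ^ 2 := natCard_geomTorsion_eq_sq W
  haveI : Finite (geomTorsion W (p : ℤ)) := Nat.finite_of_card_ne_zero (by rw [hT]; exact pow_ne_zero _ hpr.ne_zero)
  set U : Subgroup (absoluteGaloisGroup ℚ) :=
    { carrier := {g | ∀ Q : geomTorsion W (p : ℤ), g • Q = Q}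
      mul_mem' := fun {a b} ha' hb' Q ↦ by rw [mul_smul, hb' Q, ha' Q]
      one_mem' := fun Q ↦ one_smul _ Q
      inv_mem' := fun {a} ha' Q ↦ by
        conv_lhs => rw [← ha' Q]
        rw [inv_smul_smul] } with hUdef
  have hmemU : ∀ g, g ∈ U ↔ ∀ Q : geomTorsion W (p : ℤ), g • Q = Q := fun _ ↦ Iff.rfl
  have hU : IsOpen (U : Set (absoluteGaloisGroup ℚ)) := by
    have hUeq : (U : Set (absoluteGaloisGroup ℚ)) =
        ⋂ Q : geomTorsion W (p : ℤ), (fun g : absoluteGaloisGroup ℚ ↦ g • (Q : W.geomPoints)) ⁻¹' {(Q : W.geomPoints)} := by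
      ext g
      simp only [SetLike.mem_coe, hmemU, Set.mem_iInter, Set.mem_preimage, Set.mem_singleton_iff]
      refine forall_congr' fun Q ↦ ?_
      rw [← AddSubgroup.torsionBy.coe_smul]
      exact ⟨fun h ↦ by rw [h], fun h ↦ Subtype.ext h⟩
    rw [hUeq]
    exact isOpen_iInter_of_finite fun Q ↦
      (isOpen_discrete _).preimage (continuous_smul_geomPoints W (Q : W.geomPoints))
  -- Frobenius generation: `d = φⁿ · i · u`
  obtain ⟨φ, hφ⟩ := HeightOneSpectrum.exists_isArithFrobAt_of_mem_primesAbove_holds (K := ℚ) (v := v) h𝔓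
  obtain ⟨n, i, u, hi, huU, rfl⟩ := exists_eq_frobenius_pow_mul_of_mem_decompositionSubgroup h𝔓 hφ hU hd
  have hpQ : ∀ Q : geomTorsion W (p : ℤ), (p : ℤ) • (Q : W.geomPoints) = 0 := fun Q ↦
    (Submodule.mem_torsionBy_iff _ _).mp Q.2
  -- the Frobenius powers do not change reductions of `p`-torsion points
  have hredφ : ∀ (k : ℕ) (Q : geomTorsion W (p : ℤ)),
      geomReduction hΔ ((φ ^ k • Q : geomTorsion W (p : ℤ)) : W.geomPoints) = geomReduction hΔ (Q : W.geomPoints) := by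
    intro k
    induction k with
    | zero => intro Q; rw [pow_zero, one_smul]
    | succ k ih =>
      intro Q
      rw [pow_succ, mul_smul, ih, AddSubgroup.torsionBy.coe_smul,
        geomReduction_smul_eq_self_of_dvd_frobeniusTrace_sub_one hΔ hmem hv h𝔓 hφ ha _ (hpQ Q)]
  have hfix : geomReduction hΔ (((φ ^ n * i * u) • P : geomTorsion W (p : ℤ)) : W.geomPoints) =
      geomReduction hΔ (P : W.geomPoints) := by
    rw [mul_smul, mul_smul, (hmemU u).mp huU P, hredφ, AddSubgroup.torsionBy.coe_smul,
      geomReduction_smul_of_mem_inertia hΔ hmem hi]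
  apply mem_rationalLine_of_geomReduction_eq_zero hΔ hord hmem hu h𝔓 hΦ₀ hram
  rw [AddSubgroupClass.coe_sub, map_sub, hfix, sub_self]

/-- **The same at EVERY prime `𝔔` of `\bar ℤ` above `p`**: `d • P − P ∈ Φ₀` for `d ∈ D_𝔔`, `P ∈ E[p]` (`𝔔 = ρ⁻¹ 𝔓₀`,
`D_𝔔 = ρ⁻¹ D_{𝔓₀} ρ`, and `Φ₀` is `Γ_ℚ`-stable). [cite: KellerYin2024, §1.4 (arXiv:2402.12781v2 TeX L1066–1083)]
[cite: NeukirchANT1999, I §9 (9.4)–(9.5)] -/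
theorem smul_sub_mem_rationalLine_of_mem_decompositionSubgroup_of_mem_primesAbove
    (hΔ : ¬ (p : ℤ) ∣ minimalDiscriminantInt W) (ha : (p : ℤ) ∣ W.frobeniusTrace p - 1)
    {v : HeightOneSpectrum (𝓞 ℚ)} (hv : (primesEquiv v : ℕ) = p) (hu : (p : 𝓞 ℚ) ∈ v.asIdeal)
    {𝔔 : Ideal (absIntegers (𝓞 ℚ) ℚ)} (h𝔔 : 𝔔 ∈ v.primesAbove)
    {Φ₀ : AddSubgroup (geomTorsion W (p : ℤ))} (hΦ₀ : IsRationalLine W p Φ₀) (hram : ¬ LineUnramifiedAt W p Φ₀)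
    {d : absoluteGaloisGroup ℚ} (hd : d ∈ 𝔔.decompositionSubgroup (absoluteGaloisGroup ℚ))
    (P : geomTorsion W (p : ℤ)) : d • P - P ∈ Φ₀ := by
  obtain ⟨𝔓₀, hmem, h𝔓₀⟩ := exists_ideal_placeOver p hv
  obtain ⟨ρ, hρ⟩ := HeightOneSpectrum.exists_smul_eq_of_mem_primesAbove_holds (K := ℚ) (v := v) h𝔔 h𝔓₀
  have hd' : ρ * d * ρ⁻¹ ∈ 𝔓₀.decompositionSubgroup (absoluteGaloisGroup ℚ) := by
    rw [← hρ, Ideal.decompositionSubgroup_smul]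
    exact Subgroup.smul_mem_pointwise_smul _ _ _ hd
  have h := smul_sub_mem_rationalLine_of_mem_decompositionSubgroup hΔ ha hmem hv hu h𝔓₀ hΦ₀ hram hd' (ρ • P)
  rw [mul_smul, mul_smul, inv_smul_smul, ← smul_sub] at h
  have h2 := hΦ₀.2 ρ⁻¹ _ h
  rwa [inv_smul_smul] at h2

end Rat

/-! ## §2. Over `K`: `D_v̄` acts trivially on `E_K[p]/Φ` -/

section BaseChange

variable (W : WeierstrassCurve ℚ) [W.IsElliptic] [W.IsGloballyMinimal] {p : ℕ} [hp : Fact p.Prime]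
  {K : Type} [Field K] [NumberField K]

set_option synthInstance.maxHeartbeats 80000 in
-- the pointwise `MulAction` of `Γ_ℚ` on the ideals of `\bar ℤ` is slow to find (cf. `SorensenPatching`)
/-- **`D_v̄` ACTS TRIVIALLY ON `E_K[p]/Φ`** on the binders of crux 2 (`p` odd good anomalous, no unramified rational
`p`-line, `K` imaginary quadratic with `p = v v̄` split): for every `Γ_K`-stable `p`-line `Φ ≤ E_K[p]`, every
`g ∈ D_v̄ = GreenbergSelmer.decomp v̄` and every `P ∈ E_K[p]`, `g • P − P ∈ Φ` — the character `𝟙̃` of `E_K[p]/Φ` is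
trivial on the whole decomposition group at `v̄` (KY §1.4: «`ψ|_{G_p} = 𝟙`»). Transport of §1 along the equivariant
`E(ℚ̄) ≃ E_K(K̄)`: the pulled-back line is rational (`isRationalLine_of_forall_restrict_smul_mem`), hence ramified,
and `res(D_v̄) ≤ D_𝔔` for the contraction `𝔔 = 𝔓_{v̄} ∩ \bar ℤ`.
[cite: KellerYin2024, §1.4 (arXiv:2402.12781v2 TeX L1066–1083)] [cite: Serre1972, §1.11 (1), Prop. 11]
[cite: NeukirchANT1999, I §9 (9.4)–(9.6)] -/
theorem smul_sub_mem_of_mem_decomp (hp2 : p ≠ 2) (hanom : Anom W p)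
    (hGL : ∀ Φ : AddSubgroup (geomTorsion W (p : ℤ)), IsRationalLine W p Φ → ¬ LineUnramifiedAt W p Φ)
    (hK : IsImaginaryQuadratic K) {v vbar : HeightOneSpectrum (𝓞 K)} (hpv : ((p : ℕ) : 𝓞 K) ∈ v.asIdeal)
    (hpvbar : ((p : ℕ) : 𝓞 K) ∈ vbar.asIdeal) (hne : vbar ≠ v)
    {Φ : AddSubgroup (geomTorsion (W.baseChange K) (p : ℤ))} (hΦ : Nat.card Φ = p)
    (hstab : ∀ (σ : absoluteGaloisGroup K), ∀ P ∈ Φ, σ • P ∈ Φ)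
    {g : absoluteGaloisGroup K} (hg : g ∈ GreenbergSelmer.decomp vbar)
    (P : geomTorsion (W.baseChange K) (p : ℤ)) : g • P - P ∈ Φ := by
  have hpr : p.Prime := hp.out
  have hΔ : ¬ (p : ℤ) ∣ minimalDiscriminantInt W := W.not_dvd_minimalDiscriminantInt_of_hasGoodReductionAtPrime' p hanom.2.1
  -- the place `u` of `ℚ` below `v̄`, the contraction `𝔔` of `𝔓_{v̄}`
  set u : HeightOneSpectrum (𝓞 ℚ) := vbar.under (𝓞 ℚ) with hudef
  have hu : (p : 𝓞 ℚ) ∈ u.asIdeal := natCast_mem_under_rat (K := K) hpvbar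
  have hv : (primesEquiv u : ℕ) = p := primesEquiv_eq_of_natCast_mem hpr hu
  set 𝔓K : Ideal (absIntegers (𝓞 K) K) := adicCompletionPrime K vbar with h𝔓K
  set 𝔔 : Ideal (absIntegers (𝓞 ℚ) ℚ) := 𝔓K.comap (absIntegersMap ℚ K) with h𝔔def
  have h𝔔 : 𝔔 ∈ u.primesAbove := (map_absGaloisRestrict_inertia_eq_of_split (p := p) hK hpv hpvbar hne).2
  -- `res g ∈ D_𝔔`
  have hgD : g ∈ 𝔓K.decompositionSubgroup (absoluteGaloisGroup K) := by
    rw [h𝔓K, decompositionSubgroup_adicCompletionPrime_eq_range]; exact hg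
  have hgD' : absGaloisRestrict ℚ K g ∈ 𝔔.decompositionSubgroup (absoluteGaloisGroup ℚ) := by
    rw [Ideal.mem_decompositionSubgroup_iff, h𝔔def, ← comap_absIntegersMap_smul,
      Ideal.mem_decompositionSubgroup_iff.mp hgD]
  -- the equivariant identification `E(ℚ̄) ≃ E_K(K̄)` on `p`-torsion
  obtain ⟨e, he⟩ := W.exists_addEquiv_geomPoints_baseChange K
  have htors : ∀ Q : geomTorsion W (p : ℤ), e (Q : W.geomPoints) ∈ geomTorsion (W.baseChange K) (p : ℤ) := fun Q ↦ by
    refine (Submodule.mem_torsionBy_iff _ _).mpr ?_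
    change (p : ℤ) • e (Q : W.geomPoints) = 0
    rw [← map_zsmul, (Submodule.mem_torsionBy_iff _ _).mp Q.2, map_zero]
  have htors' : ∀ P : geomTorsion (W.baseChange K) (p : ℤ),
      e.symm (P : geomPoints (W.baseChange K)) ∈ geomTorsion W (p : ℤ) := fun P ↦ by
    refine (Submodule.mem_torsionBy_iff _ _).mpr ?_
    change (p : ℤ) • e.symm (P : geomPoints (W.baseChange K)) = 0
    apply e.injective
    rw [map_zsmul, AddEquiv.apply_symm_apply, map_zero]
    exact (Submodule.mem_torsionBy_iff _ _).mp P.2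
  set fT : geomTorsion W (p : ℤ) →+ geomTorsion (W.baseChange K) (p : ℤ) :=
    AddMonoidHom.codRestrict (e.toAddMonoidHom.comp (geomTorsion W (p : ℤ)).subtype) _ htors with hfTdef
  have hfT : ∀ Q : geomTorsion W (p : ℤ), ((fT Q : geomTorsion (W.baseChange K) (p : ℤ)) :
      geomPoints (W.baseChange K)) = e (Q : W.geomPoints) := fun _ ↦ rfl
  have hfTbij : Function.Bijective fT := by
    refine ⟨fun a b hab ↦ ?_, fun P ↦ ⟨⟨e.symm (P : geomPoints (W.baseChange K)), htors' P⟩, ?_⟩⟩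
    · have h := congrArg (fun z : geomTorsion (W.baseChange K) (p : ℤ) ↦ (z : geomPoints (W.baseChange K))) hab
      simp only [hfT] at h
      exact Subtype.ext (e.injective h)
    · apply Subtype.ext
      rw [hfT]
      exact e.apply_symm_apply _
  let eT : geomTorsion W (p : ℤ) ≃+ geomTorsion (W.baseChange K) (p : ℤ) := AddEquiv.ofBijective fT hfTbij
  have heT : ∀ Q : geomTorsion W (p : ℤ), ((eT Q : geomTorsion (W.baseChange K) (p : ℤ)) :
      geomPoints (W.baseChange K)) = e (Q : W.geomPoints) := fun _ ↦ rfl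
  have heT_smul : ∀ (τ : absoluteGaloisGroup K) (Q : geomTorsion W (p : ℤ)),
      eT (absGaloisRestrict ℚ K τ • Q) = τ • eT Q := fun τ Q ↦ by
    apply Subtype.ext
    rw [heT, AddSubgroup.torsionBy.coe_smul, he, AddSubgroup.torsionBy.coe_smul, heT]
  -- the pulled-back line `Ψ ≤ E[p](ℚ̄)` is rational, hence ramified
  set Ψ : AddSubgroup (geomTorsion W (p : ℤ)) := Φ.map eT.symm.toAddMonoidHom with hΨdef
  have hmemΨ : ∀ Q, Q ∈ Ψ ↔ eT Q ∈ Φ := fun Q ↦ by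
    rw [hΨdef, AddSubgroup.mem_map_equiv, AddEquiv.symm_symm]
  have hΨcard : Nat.card Ψ = p :=
    (Nat.card_congr (Φ.equivMapOfInjective eT.symm.toAddMonoidHom eT.symm.injective).toEquiv).symm.trans hΦ
  have hstabΨ : ∀ (τ : absoluteGaloisGroup K), ∀ Q ∈ Ψ, absGaloisRestrict ℚ K τ • Q ∈ Ψ := by
    intro τ Q hQ
    rw [hmemΨ] at hQ ⊢
    rw [heT_smul]
    exact hstab τ _ hQ
  have hrat : IsRationalLine W p Ψ := isRationalLine_of_forall_restrict_smul_mem hp2 hanom hGL hK hΨcard hstabΨ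
  have hramΨ : ¬ LineUnramifiedAt W p Ψ := hGL Ψ hrat
  -- §1 at `𝔔`, `d = res g`, and the point `eT⁻¹ P`
  have h := smul_sub_mem_rationalLine_of_mem_decompositionSubgroup_of_mem_primesAbove hΔ hanom.2.2 hv hu h𝔔 hrat
    hramΨ hgD' (eT.symm P)
  rw [hmemΨ, map_sub, heT_smul, AddEquiv.apply_symm_apply] at h
  exact h

end BaseChange

/-! ## §3. The local `H⁰` conjuncts of `stub_indexInputs` in the `StableSubgroup` currency -/

section Stable

variable (W : WeierstrassCurve ℚ) [W.IsElliptic] [W.IsGloballyMinimal] {p : ℕ} [hp : Fact p.Prime]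
  {K : Type} [Field K] [NumberField K] (κ : ZpExtension K p)

/-- **`htrivD` (for all of `D_v̄`)**: for a `Γ_K`-stable line `Φ` of `E_K[p]` packaged as a `StableSubgroup` (`#Φ = p`),
every `g ∈ D_v̄` acts trivially on `E_K[p]/Φ = Φ.Quot` — V21 step (5): `N_1^{G_j} = N_1 = 𝔽`.
[cite: KellerYin2024, §1.4 (arXiv:2402.12781v2 TeX L1066–1083, L1240–1260)] -/
theorem forall_smul_quot_eq_self_of_mem_decomp (hp2 : p ≠ 2) (hanom : Anom W p)
    (hGL : ∀ Φ : AddSubgroup (geomTorsion W (p : ℤ)), IsRationalLine W p Φ → ¬ LineUnramifiedAt W p Φ)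
    (hK : IsImaginaryQuadratic K) {v vbar : HeightOneSpectrum (𝓞 K)} (hpv : ((p : ℕ) : 𝓞 K) ∈ v.asIdeal)
    (hpvbar : ((p : ℕ) : 𝓞 K) ∈ vbar.asIdeal) (hne : vbar ≠ v)
    (Φ : StableSubgroup (absoluteGaloisGroup K) ↥(geomTorsion (W.baseChange K) (p : ℤ)))
    (hΦ : Nat.card Φ.Sub = p) {g : absoluteGaloisGroup K} (hg : g ∈ GreenbergSelmer.decomp vbar) :
    ∀ n : Φ.Quot, g • n = n :=
  (Φ.forall_smul_quot_eq_self_iff g).mpr fun m ↦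
    smul_sub_mem_of_mem_decomp W hp2 hanom hGL hK hpv hpvbar hne (Φ := Φ.toAddSubgroup) hΦ
      (fun σ _ hP ↦ Φ.smul_mem' σ hP) hg m

/-- **`htrivD` at v20's exact type**: the local tower group `ker κ ⊓ D_v̄` acts trivially on `E_K[p]/Φ`, for EVERY
`ℤ_p`-extension `κ`. [cite: KellerYin2024, §1.4 (arXiv:2402.12781v2 TeX L1066–1083)] -/
theorem forall_inf_decomp_smul_quot_eq_self (hp2 : p ≠ 2) (hanom : Anom W p)
    (hGL : ∀ Φ : AddSubgroup (geomTorsion W (p : ℤ)), IsRationalLine W p Φ → ¬ LineUnramifiedAt W p Φ)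
    (hK : IsImaginaryQuadratic K) {v vbar : HeightOneSpectrum (𝓞 K)} (hpv : ((p : ℕ) : 𝓞 K) ∈ v.asIdeal)
    (hpvbar : ((p : ℕ) : 𝓞 K) ∈ vbar.asIdeal) (hne : vbar ≠ v)
    (Φ : StableSubgroup (absoluteGaloisGroup K) ↥(geomTorsion (W.baseChange K) (p : ℤ)))
    (hΦ : Nat.card Φ.Sub = p) :
    ∀ (g : ↥(κ.kerSubgroup ⊓ GreenbergSelmer.decomp vbar)) (n : Φ.Quot), g • n = n :=
  fun g n ↦ forall_smul_quot_eq_self_of_mem_decomp W hp2 hanom hGL hK hpv hpvbar hne Φ hΦ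
    (Subgroup.mem_inf.mp g.2).2 n

/-- **`hN₁D` at v20's exact type: `Φ^{ker κ ⊓ D_v̄} = 0`** for EVERY `ℤ_p`-extension `κ`: the line `Φ = 𝔽(ω̃)` is moved by
`I_v̄` (`exists_mem_inertia_smul_ne`), hence by `D_v̄ ⊓ ker κ` (`p`-power descent, `eq_zero_of_mem_line_of_fixed`) —
V21 step (5): `N_ω^{G_j} = 0`. [cite: KellerYin2024, §1.3 (arXiv:2402.12781v2 TeX L944–946, L1043)] -/
theorem sub_eq_zero_of_forall_inf_decomp_smul_eq (hp2 : p ≠ 2) (hanom : Anom W p)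
    (hGL : ∀ Φ : AddSubgroup (geomTorsion W (p : ℤ)), IsRationalLine W p Φ → ¬ LineUnramifiedAt W p Φ)
    (hK : IsImaginaryQuadratic K) {v vbar : HeightOneSpectrum (𝓞 K)} (hpv : ((p : ℕ) : 𝓞 K) ∈ v.asIdeal)
    (hpvbar : ((p : ℕ) : 𝓞 K) ∈ vbar.asIdeal) (hne : vbar ≠ v)
    (Φ : StableSubgroup (absoluteGaloisGroup K) ↥(geomTorsion (W.baseChange K) (p : ℤ)))
    (hΦ : Nat.card Φ.Sub = p) :
    ∀ n : Φ.Sub, (∀ g : ↥(κ.kerSubgroup ⊓ GreenbergSelmer.decomp vbar), g • n = n) → n = 0 := by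
  intro n hn
  -- the line inside `E_K(K̄)` and its mover in `I_v̄`
  set Φ' : AddSubgroup (geomPoints (W.baseChange K)) :=
    Φ.toAddSubgroup.map (geomTorsion (W.baseChange K) (p : ℤ)).subtype with hΦ'def
  have hΦ'le : Φ' ≤ geomTorsion (W.baseChange K) (p : ℤ) := by
    rintro _ ⟨Q, -, rfl⟩; exact Q.2
  have hΦ'card : Nat.card Φ' = p := by
    rw [hΦ'def, ← Nat.card_congr (Φ.toAddSubgroup.equivMapOfInjective _ Subtype.val_injective).toEquiv]
    exact hΦ
  have hstab' : ∀ (σ : absoluteGaloisGroup K), ∀ P ∈ Φ', σ • P ∈ Φ' := by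
    rintro σ _ ⟨Q, hQ, rfl⟩
    exact ⟨σ • Q, Φ.smul_mem' σ hQ, rfl⟩
  obtain ⟨τ, hτ, P, hP, hτP⟩ := exists_mem_inertia_smul_ne W hp2 hanom hGL hK hpv hpvbar hne hΦ'le hΦ'card hstab'
  -- descent to `D_v̄ ⊓ ker κ` on the line inside the discrete `Γ_K`-module `E_K[p]`
  obtain ⟨Q, hQ, rfl⟩ := hP
  have hτQ : τ • Q ≠ Q := fun h ↦ hτP (by
    rw [AddSubgroup.coe_subtype, ← AddSubgroup.torsionBy.coe_smul, h])
  have hcont : ∀ m : geomTorsion (W.baseChange K) (p : ℤ), Continuous fun g : absoluteGaloisGroup K ↦ g • m :=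
    fun m ↦ continuous_of_injective_comp (ι := fun x : geomTorsion (W.baseChange K) (p : ℤ) ↦
      (x : geomPoints (W.baseChange K))) Subtype.val_injective
      ((W.baseChange K).continuous_smul_geomPoints (m : geomPoints (W.baseChange K)))
  have h0 := eq_zero_of_mem_line_of_fixed κ (GreenbergSelmer.decomp vbar) (isClosed_decomp vbar) hcont
    Φ.toAddSubgroup hΦ (GreenbergSelmer.inertia_le_decomp vbar hτ) (fun R hR ↦ Φ.smul_mem' τ hR) ⟨Q, hQ, hτQ⟩
    (P := Φ.incl n) n.2 (fun g hg ↦ by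
      obtain ⟨hgD, hgk⟩ := Subgroup.mem_inf.mp hg
      have := hn ⟨g, Subgroup.mem_inf.mpr ⟨hgk, hgD⟩⟩
      rw [← Φ.incl_smul]
      exact congrArg Φ.incl this)
  exact Φ.incl_injective (by rw [h0, map_zero])

/-- **`[Finite A₂^{H ⊓ D_𝔭}]` at v20's exact type**: `{x ∈ E_K[p^∞] : (ker κ ⊓ D_v̄) x = x}` is FINITE on the
anticyclotomic tower — Fin_v (`localTowerTorsionFiniteAt_of_isAnticyclotomic`, KY Prop. 1.3.3 (iii)), read in the
subtype currency. [cite: KellerYin2024, §1.3 Prop. 1.3.3 (iii) (arXiv:2402.12781v2 TeX L948–957)] -/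
theorem finite_fixed_geomPrimaryTorsion_inf_decomp (hp2 : p ≠ 2) (hanom : Anom W p)
    (hGL : ∀ Φ : AddSubgroup (geomTorsion W (p : ℤ)), IsRationalLine W p Φ → ¬ LineUnramifiedAt W p Φ)
    (hK : IsImaginaryQuadratic K) {v vbar : HeightOneSpectrum (𝓞 K)} (hpv : ((p : ℕ) : 𝓞 K) ∈ v.asIdeal)
    (hpvbar : ((p : ℕ) : 𝓞 K) ∈ vbar.asIdeal) (hne : vbar ≠ v) (hκ : κ.IsAnticyclotomic) :
    Finite {x : ↥((W.baseChange K).geomPrimaryTorsion p) //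
      ∀ g : ↥(κ.kerSubgroup ⊓ GreenbergSelmer.decomp vbar), g • x = x} := by
  have hfin := localTowerTorsionFiniteAt_of_isAnticyclotomic W hp2 hanom hGL hK hpv hpvbar hne κ hκ
  unfold LocalTowerTorsionFiniteAt at hfin
  haveI := hfin.to_subtype
  refine Finite.of_injective (fun x ↦ (⟨x.1, (FixedPoints.mem_addSubgroup _ _ _).mpr fun g ↦
    x.2 ⟨g.1, Subgroup.mem_inf.mpr (Subgroup.mem_inf.mp g.2).symm⟩⟩ :
      ↥(FixedPoints.addSubgroup ↥(GreenbergSelmer.decomp vbar ⊓ κ.kerSubgroup)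
        ((W.baseChange K).geomPrimaryTorsion p)))) fun a b hab ↦ ?_
  have h := congrArg Subtype.val hab
  exact Subtype.ext h

end Stable

end Summit.BirchSwinnertonDyer.BirchSwinnertonDyer.Theorems.AnomalousLocalTorsion

end
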